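import Literature.AlgebraicGeometry.HodgeTheory.AbelianVarietyBettiIntegralFormsComparisonRing
import Literature.AlgebraicGeometry.HodgeTheory.IntermediateJacobianComplexTorus
import Literature.AlgebraicTopology.SingularHomology.IntegralClassRingChange
import Literature.Geometry.Kaehler.ComplexTorusCoveringSpaces
import Literature.Geometry.Kaehler.ComplexTorusSiegelNormalForm
import Literature.NumberTheory.Transcendental.AbelianVarietyAnalyticLieGroup
import HarnessLib

/-!
# Integral classes of an algebraic complex torus in lattice coordinates, and re-basing a uniformisation
# to a prescribed integral frame (U-e P4b leaf (b1-F-realise))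

Topic `AlgebraicGeometry/HodgeTheory`; namespace `Literature.AlgebraicGeometry.HodgeTheory`.  KERNEL ONLY: theorems;
no definition, no named fact, no instance, no `sorry`.  Cell `hodgecm-mathlib` (D-0151), rung-0 (U)-road, U-e socket
P4b road (b-H′) «transported INTEGRAL lattice coordinates» (B-p05 (g13) census round 2, 14:19:07Z GO): the notion-free
leaf (b1-F-realise).  HC_CM is proved only modulo the 7 printed citations until rung 0 closes; nothing here changes that
count (books 0).

PRINT. [Lange2023AbelianVarietiesComplex] §1.1.3 (1.3)–(1.4) and Lemma 1.1.17 (a) (p. 14): `π₁(X) = H₁(X, ℤ) = Λ`,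
`H¹(X, ℤ) = Hom(Λ, ℤ)` canonically — so a class in `H¹(X, ℚ) = Hom(Λ, ℚ)` is integral iff its values on the lattice
basis (its canonical lattice coordinates) are integers, and the dual basis of ANY `ℤ`-basis of `H¹(X, ℤ)` is a `ℤ`-basis
of `Λ`, i.e. the lattice frame of the re-based presentation `V/Φ(Pℤ^ι)`, `P ∈ GL_ι(ℤ)` (§1.1.2 Prop. 1.1.6 ff.:
`ρ(P)` is an isomorphism of complex tori with identity analytic representation); [HatcherAT2002] §3.1 p. 198 (change of
coefficients, naturality).  Read on the algebraic carrier through the analytification `φ` ([SerreGAGA1956] §2).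

* §1 `isIntegralClass_ofRatClass_latticeClass` (the canonical classes `ξₐ` are integral),
  `isIntegralClass_Motives.ofRatClass_map_iff_of_homeomorph` (integrality is invariant under homeomorphisms),
  `isIntegralClass_ofRatClass_iff_forall_latticeCoordHOne` (a class on the torus is integral iff its canonical lattice
  coordinates are integers — Kronecker duality with the lattice loops, ★ `AbelianVarietyBettiIntegralFormsComparisonRing`
  §3), **`mem_integralLattice_iff_forall_latticeCoordHOne_map`** (the same on `H¹(X(ℂ); ℚ)` for a scheme `X`
  homeomorphically uniformised by the torus) and **`exists_basis_integralLattice_map_eq_latticeClass`** (the pulled-back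
  lattice classes form a `ℤ`-BASIS of `integralLattice X 1 = H¹(X(ℂ); ℤ)/tors`).
* §2 `isRiemannForm_sublatticePeriod`, `latticeGram_sublatticePeriod` (transport of a Riemann form and of its Gram
  matrix to the re-based presentation ★ `ComplexTorus.sublatticePeriod Φ P = Φ ∘ P_ℝ`), and
  **`exists_rebase_of_basis_integralLattice`**: every `ℤ`-basis `c` of `integralLattice X 1` is the lattice-class frame
  of a re-based uniformisation `(Φ' ∘ P_ℝ, φ' ∘ ρ(P))`, `P ∈ GL_ι(ℤ)`, which is again an analytification (and additive
  when `φ'` is) — exactly the input block `(Φ, φ, hφ, hadd)` of ★ `exists_siegelAdelicMarking_of_hodgeFrame`.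

## References
* [Lange2023AbelianVarietiesComplex] H. Lange, *Abelian Varieties over the Complex Numbers* (2023), §1.1.2 Prop. 1.1.6
  (p. 8), §1.1.3 (1.3), (1.4), Lemma 1.1.17 (a) (pp. 13–14).
* [HatcherAT2002] A. Hatcher, *Algebraic Topology* (2002), §3.1 p. 198, §3.2 Example 3.16.
* [SerreGAGA1956] J.-P. Serre, *Géométrie algébrique et géométrie analytique* (1956), §2.
-/

set_option autoImplicit false

noncomputable section

-- `ComplexTorus Φ` (for `Φ : ℝ^ι ≃ E`) is the type `ι → ℝ/ℤ`; instance paths up to unfolding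
set_option backward.isDefEq.respectTransparency false

open scoped Manifold ContDiff Matrix
open CategoryTheory Matrix Module
open Literature.AlgebraicTopology.SingularHomology
open Literature.NumberTheory.Transcendental (IsAnalytification)
open Literature.Geometry.Kaehler Literature.Geometry.Kaehler.ComplexTorus
open Literature.AlgebraicGeometry.Motives (ComplexPoints SchemeOver AbelianVariety)

namespace Literature.AlgebraicGeometry.HodgeTheory

/-! ### §1 Integral classes in canonical lattice coordinates -/

section Integral

variable {ι : Type} [Fintype ι] [DecidableEq ι] {E : Type} [NormedAddCommGroup E] [NormedSpace ℂ E]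
  [FiniteDimensional ℂ E] (Φ : (ι → ℝ) ≃L[ℝ] E)

omit [Fintype ι] [DecidableEq ι] [FiniteDimensional ℂ E] in
/-- **The canonical classes `ξₐ = latticeClass Φ a` are integral** (`ξₐ` is the pull-back of the fundamental class of
`ℝ/ℤ`, which is the image of the integral fundamental class, ★ `ringChange_circleClass`).
[cite: Lange2023AbelianVarietiesComplex, §1.1.3 Lemma 1.1.17 (a) (p. 14)] [cite: HatcherAT2002, §3.2 Example 3.16] -/
theorem isIntegralClass_ofRatClass_latticeClass (a : ι) :
    IsIntegralClass (ofRatClass (ComplexTorus Φ) 1 (latticeClass Φ a)) := by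
  rw [isIntegralClass_iff_mem_range_ringChange, latticeClass, Motives.ofRatClass_map, ofRatClass_eq_ringChange,
    ringChange_circleClass]
  refine ⟨singularCohomology.map ℤ ℤ (latticeCircle Φ a) 1 (circleClass ℤ), ?_⟩
  rw [singularCohomology.ringChange_map, ringChange_circleClass]

/-- **Integrality of a rational class is invariant under homeomorphisms**: for a homeomorphism `e : T ≃ Y` and
`x ∈ H¹(Y; ℚ)` (any degree `k`), `e^* x` is integral iff `x` is (pull back along `e` and `e⁻¹`; change of coefficients
commutes with pull-back, ★ `singularCohomology.ringChange_map`). [cite: HatcherAT2002, §3.1 p. 198] -/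
theorem isIntegralClass_Motives.ofRatClass_map_iff_of_homeomorph {T Y : Type} [TopologicalSpace T] [TopologicalSpace Y]
    (e : T ≃ₜ Y) {k : ℕ} (x : singularCohomology ℚ ℚ Y k) :
    IsIntegralClass (ofRatClass T k (singularCohomology.map ℚ ℚ (e : C(T, Y)) k x)) ↔
      IsIntegralClass (ofRatClass Y k x) := by
  -- pull-back preserves integrality (for any continuous map)
  have key : ∀ {T' Y' : Type} [TopologicalSpace T'] [TopologicalSpace Y'] (f : C(T', Y'))
      (y : singularCohomology ℚ ℚ Y' k), IsIntegralClass (ofRatClass Y' k y) →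
        IsIntegralClass (ofRatClass T' k (singularCohomology.map ℚ ℚ f k y)) := by
    intro T' Y' _ _ f y hy
    rw [isIntegralClass_iff_mem_range_ringChange] at hy ⊢
    obtain ⟨z, hz⟩ := hy
    refine ⟨singularCohomology.map ℤ ℤ f k z, ?_⟩
    rw [singularCohomology.ringChange_map, hz, Motives.ofRatClass_map]
  refine ⟨fun h => ?_, key (e : C(T, Y)) x⟩
  have h2 := key (e.symm : C(Y, T)) _ h
  rwa [singularCohomology.map_map, show (e : C(T, Y)).comp (e.symm : C(Y, T)) = ContinuousMap.id Y from
    ContinuousMap.ext fun y => e.apply_symm_apply y, singularCohomology.map_id] at h2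

/-- **A rational class on the torus is integral iff its canonical lattice coordinates are integers**
(`H¹(X, ℤ) = Hom(Λ, ℤ) ⊂ Hom(Λ, ℚ) = H¹(X, ℚ)`): for `z ∈ H¹(E/Φ(ℤ^ι); ℚ)`, `z ⊗ 1` is integral iff
`latticeCoordHOne Φ z b ∈ ℤ` for all `b`.  (⇐): `z = Σ_b z_b ξ_b` with the `ξ_b` integral; (⇒): `z_b = ⟨z, h(λ_b)⟩` is the
Kronecker pairing with the lattice loop (★ `kroneckerPairing_loopClass_latticeLoop_single_eq_latticeCoordHOne`), an
integer when `z ⊗ 1` comes from `H¹(; ℤ)` (★ `kroneckerPairing_ringChange_loopClass`).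
[cite: Lange2023AbelianVarietiesComplex, §1.1.3 (1.3)–(1.4) and Lemma 1.1.17 (a) (pp. 13–14)] [cite: HatcherAT2002, §3.1 p. 198] -/
theorem isIntegralClass_ofRatClass_iff_forall_latticeCoordHOne (z : singularCohomology ℚ ℚ (ComplexTorus Φ) 1) :
    IsIntegralClass (ofRatClass (ComplexTorus Φ) 1 z) ↔
      ∀ b, latticeCoordHOne Φ z b ∈ Set.range (Int.cast : ℤ → ℚ) := by
  constructor
  · intro hz b
    obtain ⟨y, hy⟩ := (isIntegralClass_iff_mem_range_ringChange _).1 hz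
    -- pair both integral and rational class with the lattice loop `λ_b`, in `ℂ`
    have hq := kroneckerPairing_ringChange_loopClass (algebraMap ℚ ℂ)
      (ComplexTorus.latticeLoop Φ (Pi.single b 1)) z
    have hzint := kroneckerPairing_ringChange_loopClass (Int.castRingHom ℂ)
      (ComplexTorus.latticeLoop Φ (Pi.single b 1)) y
    rw [hy] at hzint
    rw [← ofRatClass_eq_ringChange, hzint, kroneckerPairing_loopClass_latticeLoop_single_eq_latticeCoordHOne,
      eq_comm] at hq
    refine ⟨kroneckerPairing ℤ ℤ (ComplexTorus Φ) 1 y (loopClass ℤ ℤ (1 : ℤ) (ComplexTorus.latticeLoop Φ (Pi.single b 1))),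
      ?_⟩
    have hq' : ((latticeCoordHOne Φ z b : ℚ) : ℂ) =
        ((kroneckerPairing ℤ ℤ (ComplexTorus Φ) 1 y
          (loopClass ℤ ℤ (1 : ℤ) (ComplexTorus.latticeLoop Φ (Pi.single b 1))) : ℤ) : ℂ) := hq
    exact_mod_cast hq'.symm
  · intro h
    choose n hn using h
    have hz : z = ∑ b, (n b : ℚ) • latticeClass Φ b := by
      conv_lhs => rw [← (latticeCoordHOne Φ).symm_apply_apply z, latticeCoordHOne_symm_apply]
      exact Finset.sum_congr rfl fun b _ => by rw [← hn b]
    rw [hz, map_sum]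
    refine Finset.induction_on (Finset.univ : Finset ι) (by simpa using IsIntegralClass.zero) ?_
    intro b s hb ih
    rw [Finset.sum_insert hb]
    refine IsIntegralClass.add ?_ ih
    have h1 : ofRatClass (ComplexTorus Φ) 1 ((n b : ℚ) • latticeClass Φ b) =
        ((n b : ℤ) : ℂ) • ofRatClass (ComplexTorus Φ) 1 (latticeClass Φ b) := by
      rw [Int.cast_smul_eq_zsmul, map_zsmul, Int.cast_smul_eq_zsmul]
    rw [h1]
    exact (isIntegralClass_ofRatClass_latticeClass Φ b).zsmul (n b)

variable {X : SchemeOver ℂ} (φ : C(ComplexTorus Φ, ComplexPoints X))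

/-- **INTEGRAL CLASSES OF A TORUS-UNIFORMISED SCHEME IN LATTICE COORDINATES.**  For a complex torus `E/Φ(ℤ^ι)`
uniformising `X(ℂ)` by a homeomorphism `φ` (e.g. an analytification, ★ `IsAnalytification.isHomeomorph`) and
`x ∈ H¹(X(ℂ); ℚ)`: `x` lies in the integral lattice `H¹(X(ℂ); ℤ)/tors` (★ `integralLattice X 1`) iff the canonical
lattice coordinates of `φ^* x` are integers — i.e. the integral classes are EXACTLY the `ℤ`-span of the pulled-back
lattice classes. [cite: Lange2023AbelianVarietiesComplex, §1.1.3 (1.3)–(1.4) and Lemma 1.1.17 (a) (pp. 13–14)]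
[cite: SerreGAGA1956, §2] -/
theorem mem_integralLattice_iff_forall_latticeCoordHOne_map (hφ : IsHomeomorph φ)
    (x : singularCohomology ℚ ℚ (ComplexPoints X) 1) :
    x ∈ integralLattice X 1 ↔
      ∀ b, latticeCoordHOne Φ (singularCohomology.map ℚ ℚ φ 1 x) b ∈ Set.range (Int.cast : ℤ → ℚ) := by
  have hcoe : ((hφ.homeomorph φ : ComplexTorus Φ ≃ₜ ComplexPoints X) : C(ComplexTorus Φ, ComplexPoints X)) = φ :=
    ContinuousMap.ext fun _ => rfl
  rw [mem_integralLattice_iff, ← isIntegralClass_Motives.ofRatClass_map_iff_of_homeomorph (hφ.homeomorph φ), hcoe,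
    isIntegralClass_ofRatClass_iff_forall_latticeCoordHOne]

/-- **THE PULLED-BACK LATTICE CLASSES FORM A `ℤ`-BASIS OF `H¹(X(ℂ); ℤ)/tors`**: there is a `ℤ`-basis `ℓ` of
`integralLattice X 1` with `φ^* (ℓ a) = ξₐ = latticeClass Φ a` for every `a` (the dual of the lattice basis,
`H¹(X, ℤ) = Hom(Λ, ℤ)`, read on the algebraic carrier).
[cite: Lange2023AbelianVarietiesComplex, §1.1.3 Lemma 1.1.17 (a) (p. 14)] [cite: SerreGAGA1956, §2] -/
theorem exists_basis_integralLattice_map_eq_latticeClass (hφ : IsHomeomorph φ) :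
    ∃ ℓ : Basis ι ℤ (integralLattice X 1),
      ∀ a, singularCohomology.map ℚ ℚ φ 1 ((ℓ a : integralLattice X 1) : singularCohomology ℚ ℚ (ComplexPoints X) 1)
        = latticeClass Φ a := by
  classical
  -- `φ^*` as a linear equivalence
  have hcoe : ((hφ.homeomorph φ : ComplexTorus Φ ≃ₜ ComplexPoints X) : C(ComplexTorus Φ, ComplexPoints X)) = φ :=
    ContinuousMap.ext fun _ => rfl
  let eφ : singularCohomology ℚ ℚ (ComplexPoints X) 1 ≃ₗ[ℚ] singularCohomology ℚ ℚ (ComplexTorus Φ) 1 :=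
    (singularCohomology.mapIso ℚ ℚ (hφ.homeomorph φ) 1).toLinearEquiv
  have heφ : ∀ y, eφ y = singularCohomology.map ℚ ℚ φ 1 y := by
    intro y
    change (singularCohomology.mapIso ℚ ℚ (hφ.homeomorph φ) 1).hom y = _
    rw [singularCohomology.mapIso_hom, hcoe]
  -- the candidate classes `l a := (φ^*)⁻¹ ξ_a`, integral
  let l : ι → singularCohomology ℚ ℚ (ComplexPoints X) 1 := fun a => eφ.symm (latticeClass Φ a)
  have hl : ∀ a, singularCohomology.map ℚ ℚ φ 1 (l a) = latticeClass Φ a := fun a => by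
    rw [← heφ]; exact eφ.apply_symm_apply _
  have hlint : ∀ a, l a ∈ integralLattice X 1 := fun a => by
    rw [mem_integralLattice_iff_forall_latticeCoordHOne_map Φ φ hφ, hl, latticeCoordHOne_latticeClass]
    intro b
    by_cases hab : b = a
    · subst hab; exact ⟨1, by simp⟩
    · exact ⟨0, by simp [hab]⟩
  let l' : ι → integralLattice X 1 := fun a => ⟨l a, hlint a⟩
  -- linear independence over `ℤ` (from `ℚ`-independence of the `ξ_a`)
  have hli : LinearIndependent ℤ l' := by
    have hlq : LinearIndependent ℚ l := by
      have h := (linearIndependent_latticeClass Φ).map' eφ.symm.toLinearMap eφ.symm.ker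
      exact h
    have hlz : LinearIndependent ℤ l := hlq.restrict_scalars' ℤ
    exact (LinearIndependent.of_comp (integralLattice X 1).subtype (by exact hlz))
  -- spanning over `ℤ`
  have hsp : ⊤ ≤ Submodule.span ℤ (Set.range l') := by
    rintro ⟨x, hx⟩ -
    obtain hcoord := (mem_integralLattice_iff_forall_latticeCoordHOne_map Φ φ hφ x).1 hx
    choose n hn using hcoord
    have hx' : x = ∑ a, (n a : ℤ) • l a := by
      apply eφ.injective
      rw [heφ, map_sum]
      conv_lhs => rw [← (latticeCoordHOne Φ).symm_apply_apply (singularCohomology.map ℚ ℚ φ 1 x),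
        latticeCoordHOne_symm_apply]
      refine Finset.sum_congr rfl fun a _ => ?_
      rw [map_zsmul, heφ, hl, ← hn a, Int.cast_smul_eq_zsmul]
    have hmem : (⟨x, hx⟩ : integralLattice X 1) = ∑ a, (n a : ℤ) • l' a := by
      apply Subtype.ext
      show x = _
      rw [hx', AddSubmonoidClass.coe_finsetSum]
      exact Finset.sum_congr rfl fun a _ => by rw [Submodule.coe_smul_of_tower]
    rw [hmem]
    exact Submodule.sum_mem _ fun a _ => Submodule.smul_mem _ _ (Submodule.subset_span ⟨a, rfl⟩)
  exact ⟨Basis.mk hli hsp, fun a => by rw [Basis.mk_apply]; exact hl a⟩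

end Integral

/-! ### §2 Re-basing a uniformisation to a prescribed integral frame -/

section Rebase

variable {ι : Type} [Fintype ι] [DecidableEq ι] {E : Type} [NormedAddCommGroup E] [NormedSpace ℂ E]

/-- **A Riemann form stays a Riemann form for the re-based presentation** `Φ ∘ P_ℝ` (`det P ≠ 0`; the lattice
`Φ(Pℤ^ι) ⊆ Φ(ℤ^ι)` only shrinks, so integrality persists; type `(1,1)` and positivity do not see the lattice).
[cite: Lange2023AbelianVarietiesComplex, §1.1.2 Prop. 1.1.6 (p. 8)] -/
theorem isRiemannForm_sublatticePeriod (Φ : (ι → ℝ) ≃L[ℝ] E) {η : E [⋀^Fin 2]→L[ℝ] ℝ}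
    (hη : IsRiemannForm Φ η) (P : Matrix ι ι ℤ) (hP : P.det ≠ 0) :
    IsRiemannForm (ComplexTorus.sublatticePeriod Φ P hP) η := by
  refine ⟨hη.1, fun m n => ?_, hη.2.2⟩
  have hcast : ∀ m : ι → ℤ, (P.map (Int.cast : ℤ → ℝ)) *ᵥ intVec m = intVec (P *ᵥ m) := fun m => by
    funext i
    simp [intVec, Matrix.mulVec, dotProduct, Matrix.map_apply]
  rw [ComplexTorus.sublatticePeriod_apply, ComplexTorus.sublatticePeriod_apply, hcast, hcast]
  exact hη.2.1 _ _

/-- **The Gram matrix of the re-based presentation**: `latticeGram (Φ ∘ P_ℝ) η = P_ℝᵀ · latticeGram Φ η · P_ℝ`.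
[cite: Lange2023AbelianVarietiesComplex, §1.1.2 (1.2) and §1.5.1] -/
theorem latticeGram_sublatticePeriod (Φ : (ι → ℝ) ≃L[ℝ] E) (η : E [⋀^Fin 2]→L[ℝ] ℝ)
    (P : Matrix ι ι ℤ) (hP : P.det ≠ 0) :
    latticeGram (ComplexTorus.sublatticePeriod Φ P hP) η =
      (P.map (Int.cast : ℤ → ℝ))ᵀ * latticeGram Φ η * P.map (Int.cast : ℤ → ℝ) := by
  ext i j
  rw [latticeGram_apply, ComplexTorus.sublatticePeriod_apply, ComplexTorus.sublatticePeriod_apply,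
    ← dotProduct_latticeGram_mulVec, Matrix.mulVec_single_one, Matrix.mulVec_single_one, Matrix.dotProduct_mulVec]
  simp only [dotProduct, Matrix.vecMul, Matrix.mul_apply, Matrix.transpose_apply, Matrix.col_apply]

variable {X : SchemeOver ℂ} {n : ℕ}

/-- **RE-BASING A UNIFORMISATION TO A PRESCRIBED INTEGRAL FRAME** (U-e P4b leaf (b1-F-realise)).  Let the complex
torus `E/Φ'(ℤ^ι)` analytify `X` via `φ'`, and let `c` be ANY `ℤ`-basis of the integral lattice `H¹(X(ℂ); ℤ)/tors`
(★ `integralLattice X 1`).  Then there is a unimodular integer matrix `P` such that the re-based presentation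
`Φ := Φ' ∘ P_ℝ` (★ `ComplexTorus.sublatticePeriod`; same lattice, basis changed by `P`) together with
`φ := φ' ∘ ρ(P)` (★ `exists_homeomorph_of_baseChange`: `ρ(P) = mapMatrix P` is an additive biholomorphic isomorphism
`E/Φ(ℤ^ι) ⥲ E/Φ'(ℤ^ι)` with identity analytic representation) is again an analytification of `X`, and its lattice
classes are the prescribed frame: `φ^* (c a) = ξₐ = latticeClass Φ a`.  (`P = (c.toMatrix ℓ)ᵀ` for the lattice-class
basis `ℓ` of ★ `exists_basis_integralLattice_map_eq_latticeClass`; ★ `map_latticeClass_of_mapMatrix`.)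
[cite: Lange2023AbelianVarietiesComplex, §1.1.2 Prop. 1.1.6 (p. 8) and §1.1.3 Lemma 1.1.17 (a) (p. 14)]
[cite: SerreGAGA1956, §2] -/
theorem exists_rebase_of_basis_integralLattice [FiniteDimensional ℂ E] (Φ' : (ι → ℝ) ≃L[ℝ] E)
    (φ' : C(ComplexTorus Φ', ComplexPoints X)) (hφ' : IsAnalytification E X n φ')
    (c : Basis ι ℤ (integralLattice X 1)) :
    ∃ (P : Matrix ι ι ℤ) (hP : P.det ≠ 0)
      (φ : C(ComplexTorus (ComplexTorus.sublatticePeriod Φ' P hP), ComplexPoints X)),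
      IsUnit P.det ∧ IsAnalytification E X n φ ∧
      (∀ t, φ t = φ' (ComplexTorus.mapMatrix (ComplexTorus.sublatticePeriod Φ' P hP) Φ' P t)) ∧
      (∀ s t, φ (s + t) = φ' (ComplexTorus.mapMatrix (ComplexTorus.sublatticePeriod Φ' P hP) Φ' P s +
        ComplexTorus.mapMatrix (ComplexTorus.sublatticePeriod Φ' P hP) Φ' P t)) ∧
      ∀ a, singularCohomology.map ℚ ℚ φ 1 ((c a : integralLattice X 1) : singularCohomology ℚ ℚ (ComplexPoints X) 1)
        = latticeClass (ComplexTorus.sublatticePeriod Φ' P hP) a := by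
  classical
  obtain ⟨ℓ, hℓ⟩ := exists_basis_integralLattice_map_eq_latticeClass Φ' φ' hφ'.isHomeomorph
  -- the unimodular base change
  set P : Matrix ι ι ℤ := (c.toMatrix ℓ)ᵀ with hPdef
  set Q : Matrix ι ι ℤ := (ℓ.toMatrix c)ᵀ with hQdef
  have hPQ : P * Q = 1 := by
    rw [hPdef, hQdef, ← Matrix.transpose_mul, Module.Basis.toMatrix_mul_toMatrix_flip, Matrix.transpose_one]
  have hQP : Q * P = 1 := by
    rw [hPdef, hQdef, ← Matrix.transpose_mul, Module.Basis.toMatrix_mul_toMatrix_flip, Matrix.transpose_one]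
  have hPunit : IsUnit P.det := by
    have h : P.det * Q.det = 1 := by rw [← Matrix.det_mul, hPQ, Matrix.det_one]
    exact IsUnit.of_mul_eq_one _ h
  have hP : P.det ≠ 0 := hPunit.ne_zero
  -- the re-based presentation and the isomorphism `ρ(P)`
  set Φ : (ι → ℝ) ≃L[ℝ] E := ComplexTorus.sublatticePeriod Φ' P hP with hΦdef
  obtain ⟨e, he, -, headd, hehol, -⟩ := exists_homeomorph_of_baseChange Φ Φ' P Q hPQ hQP
    (ContinuousLinearEquiv.refl ℝ E) (fun u => rfl) (fun x => by
      rw [ContinuousLinearEquiv.refl_apply, hΦdef, ComplexTorus.sublatticePeriod_apply])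
  let φ : C(ComplexTorus Φ, ComplexPoints X) := ⟨φ' ∘ e, φ'.continuous.comp e.continuous⟩
  have hφcoe : (φ : ComplexTorus Φ → ComplexPoints X) = φ' ∘ e := rfl
  have hφan : IsAnalytification E X n φ := by
    rw [hφcoe]
    exact hφ'.comp_of_isHomeomorph e.isHomeomorph (hehol.mdifferentiable (by simp)) rfl
  refine ⟨P, hP, φ, hPunit, hφan, fun t => by rw [hφcoe, Function.comp_apply, he], fun s t => by
    rw [hφcoe, Function.comp_apply, headd, he, he], fun a => ?_⟩
  -- lattice classes: `φ^* (c a) = ρ(P)^* (φ'^* (c a)) = Σ_{a'} N a a' ρ(P)^* ξ'_{a'} = ξ_a`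
  have hcomp : φ = φ'.comp (e : C(ComplexTorus Φ, ComplexTorus Φ')) := ContinuousMap.ext fun _ => rfl
  have hca : ((c a : integralLattice X 1) : singularCohomology ℚ ℚ (ComplexPoints X) 1) =
      ∑ a', (ℓ.repr (c a) a' : ℤ) • ((ℓ a' : integralLattice X 1) : singularCohomology ℚ ℚ (ComplexPoints X) 1) := by
    conv_lhs => rw [← ℓ.sum_repr (c a)]
    rw [AddSubmonoidClass.coe_finsetSum]
    exact Finset.sum_congr rfl fun a' _ => by rw [Submodule.coe_smul_of_tower]
  rw [hcomp, ← singularCohomology.map_map, hca, map_sum, map_sum]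
  have hterm : ∀ a', singularCohomology.map ℚ ℚ (e : C(ComplexTorus Φ, ComplexTorus Φ')) 1
      (singularCohomology.map ℚ ℚ φ' 1
        ((ℓ.repr (c a) a' : ℤ) • ((ℓ a' : integralLattice X 1) : singularCohomology ℚ ℚ (ComplexPoints X) 1))) =
      ∑ d, (((ℓ.repr (c a) a' : ℤ) : ℚ) * (P a' d : ℚ)) • latticeClass Φ d := by
    intro a'
    rw [map_zsmul, map_zsmul, hℓ, map_latticeClass_of_mapMatrix Φ Φ' P _ he a', Finset.smul_sum]
    refine Finset.sum_congr rfl fun d _ => ?_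
    rw [← Int.cast_smul_eq_zsmul ℚ, smul_smul]
  rw [Finset.sum_congr rfl fun a' _ => hterm a', Finset.sum_comm]
  -- `Σ_{a'} N a a' P a' d = (Q P) a d = δ_{a d}`
  have hNP : ∀ d, ∑ a', (((ℓ.repr (c a) a' : ℤ) : ℚ) * (P a' d : ℚ)) • latticeClass Φ d =
      (if a = d then (1 : ℚ) else 0) • latticeClass Φ d := by
    intro d
    rw [← Finset.sum_smul]
    congr 1
    have h2 : (Q * P) a d = ∑ a', ℓ.repr (c a) a' * P a' d := by
      rw [Matrix.mul_apply]
      exact Finset.sum_congr rfl fun a' _ => by rw [hQdef, Matrix.transpose_apply, Module.Basis.toMatrix_apply]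
    have h3 : ∑ a', ((ℓ.repr (c a) a' : ℤ) : ℚ) * (P a' d : ℚ) = (((Q * P) a d : ℤ) : ℚ) := by
      rw [h2]; push_cast; rfl
    rw [h3, hQP, Matrix.one_apply]
    split_ifs <;> simp
  simp only [hNP, ite_smul, one_smul, zero_smul, Finset.sum_ite_eq, Finset.mem_univ, if_true]
  rfl

/-- **The additive rider for an abelian variety**: if the uniformisation `φ'` of `A(ℂ)` is a group homomorphism, so
is the re-based one `φ = φ' ∘ ρ(P)` (`ρ(P)` is additive) — i.e. `exists_rebase_of_basis_integralLattice` delivers the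
block `(Φ, φ, hφ, hadd)` consumed by ★ `exists_siegelAdelicMarking_of_hodgeFrame`, with lattice-class frame the
prescribed `ℤ`-basis `c` of `H¹(A(ℂ); ℤ)/tors`. [cite: Lange2023AbelianVarietiesComplex, §1.1.2 Prop. 1.1.6 (p. 8) and §1.1.3 Lemma 1.1.17 (a) (p. 14)]
[cite: SerreGAGA1956, §2] -/
theorem exists_rebase_of_basis_integralLattice_of_add [FiniteDimensional ℂ E] (A : AbelianVariety ℂ)
    (Φ' : (ι → ℝ) ≃L[ℝ] E) (φ' : C(ComplexTorus Φ', ComplexPoints A.X)) (hφ' : IsAnalytification E A.X A.dim φ')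
    (hadd' : ∀ x y, φ' (x + y) = φ' x * φ' y) (c : Basis ι ℤ (integralLattice A.X 1)) :
    ∃ (P : Matrix ι ι ℤ) (hP : P.det ≠ 0)
      (φ : C(ComplexTorus (ComplexTorus.sublatticePeriod Φ' P hP), ComplexPoints A.X)),
      IsUnit P.det ∧ IsAnalytification E A.X A.dim φ ∧
      (∀ t, φ t = φ' (ComplexTorus.mapMatrix (ComplexTorus.sublatticePeriod Φ' P hP) Φ' P t)) ∧
      (∀ s t, φ (s + t) = φ s * φ t) ∧
      ∀ a, singularCohomology.map ℚ ℚ φ 1 ((c a : integralLattice A.X 1) : singularCohomology ℚ ℚ (ComplexPoints A.X) 1)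
        = latticeClass (ComplexTorus.sublatticePeriod Φ' P hP) a := by
  obtain ⟨P, hP, φ, hPu, hφ, hρ, hadd, hcls⟩ := exists_rebase_of_basis_integralLattice Φ' φ' hφ' c
  exact ⟨P, hP, φ, hPu, hφ, hρ, fun s t => by rw [hadd, hadd', ← hρ, ← hρ], hcls⟩

end Rebase

end Literature.AlgebraicGeometry.HodgeTheory

end
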